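import Mathlib
import Literature.Analysis.ODE.HighOrderEnclosure
import Literature.Analysis.ODE.HighOrderEnclosureIntervalTest
import Literature.Analysis.ODE.SmoothFieldTaylorCoefficients
import Literature.Analysis.ODE.SmoothFieldIntervalTest
import HarnessLib

/-!
# The high-order enclosure test for a field defined on an open domain

`Literature.Analysis.ODE.highOrderEnclosure_step` (`HighOrderEnclosure.lean`; Nedialkov–Jackson–
Pryce 2001 §3) proves Lohner's constant high-order enclosure (HOE) step in two halves: a solution
of `y' = f(y)` from `y₀` EXISTS on `[0, h]` inside the a-priori box `S`
(`exists_solution_of_highOrderEnclosure`, no growth hypothesis), and EVERY solution from `y₀`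
is that one (`solution_mem_of_highOrderEnclosure`), the latter under the hypothesis `hloc` that
the right-hand side is Lipschitz on every bounded subset of the whole space.  For the
non-polynomial fields of interval Taylor-series integrators — quotients, logarithms, square roots,
real powers (Moore 1979 §3.4 (3.19)) — the field is smooth only on an open domain `Ω` and `hloc`
is not available (in Lean the field is a total function with arbitrary values off `Ω`).

The textbook uniqueness argument needs much less than `hloc`: local existence-and-uniqueness
near each point of ONE solution already forces every other solution with the same initial value
to coincide with it on the common interval — "let `(t₋, t₊)` be the maximal interval on which both
solutions coincide; if `t₊ < T₊` they coincide at `t₊` by continuity and then on a neighbourhood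
of `t₊` by local uniqueness, contradicting maximality" (Teschl 2012 §2.6, the paragraph preceding
Theorem 2.13; local uniqueness for locally Lipschitz fields is Theorem 2.2 / Theorem 2.5).  We
formalise exactly this continuation argument as a real induction
(`IsClosed.Icc_subset_of_forall_mem_nhdsWithin`) on top of Mathlib's Grönwall-based
`ODE_solution_unique_of_mem_Icc_right`:

* `ODE_solution_unique_of_lipschitzOnWith_nhds` — if `v` is Lipschitz on SOME neighbourhood of
  each point `y t` of one solution `y` on `[a, b]`, every solution `z` on `[a, b]` with `z a = y a`
  equals `y` on `[a, b]` (no hypothesis on `v` near `z`);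
* `solution_mem_of_highOrderEnclosure_local`, `highOrderEnclosure_step_local` — the HOE step of
  `HighOrderEnclosure.lean` with `hloc` replaced by "`f` is Lipschitz near every point of `S`";
* `exists_lipschitzOnWith_nhds_of_contDiffOn` — a `C^∞` (indeed `C¹`) field on an open `Ω` is
  Lipschitz near every point of `Ω` (Teschl 2012 §2.2 Problem 2.5);
* `highOrderEnclosure_step_smoothOn_local` — the smooth-field HOE step of
  `SmoothFieldTaylorCoefficients.lean` for `f ∈ C^∞(Ω)`, `S ⊆ Ω` compact convex, WITHOUT `hloc`;
* `highOrderEnclosure_step_intervalTest_smoothOn_local`, `highOrderEnclosure_tube_smoothOn_local`,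
  `highOrderEnclosure_endpoint_smoothOn_local` — the box-data HOE test of
  `SmoothFieldIntervalTest.lean` (`∑_{j<K} T^j · E_j + T^K · V ⊆ S`, Moore 1979 §8.1 (8.10),
  (8.13); NJP 2001 §3) for such fields: box data plus `boxSet S ⊆ Ω` only.
-/

noncomputable section

open Set Metric Filter Topology NonemptyInterval TopologicalSpace

open scoped NNReal ContDiff

namespace Literature.Analysis.ODE

/-! ### Uniqueness from a Lipschitz condition along one solution -/

section Uniqueness

variable {E : Type*} [NormedAddCommGroup E] [NormedSpace ℝ E]

/-- **Uniqueness on the common interval from local uniqueness along one solution** (Teschl 2012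
§2.6, the continuation argument preceding Theorem 2.13, with the local uniqueness of Theorem 2.2
supplied by Grönwall's inequality on a neighbourhood where the field is Lipschitz).  Let `y` and
`z` solve the autonomous equation `x' = v(x)` on `[a, b]` (derivatives within `[a, b]`) with
`y a = z a`, and suppose that `v` is Lipschitz on some neighbourhood of `y t` for every
`t ∈ [a, b]`.  Then `y = z` on `[a, b]`.  No hypothesis is made on `v` near the second solution:
the set where the two coincide is closed, contains `a`, and is open to the right by local
uniqueness started at a coincidence point — so it is all of `[a, b]`.
[cite: Teschl2012, §2.6 (uniqueness on the common interval, before Theorem 2.13) and §2.2 Theorem 2.2] -/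
theorem ODE_solution_unique_of_lipschitzOnWith_nhds {v : E → E} {y z : ℝ → E} {a b : ℝ}
    (hv : ∀ t ∈ Icc a b, ∃ K : ℝ≥0, ∃ U ∈ 𝓝 (y t), LipschitzOnWith K v U)
    (hy : ∀ t ∈ Icc a b, HasDerivWithinAt y (v (y t)) (Icc a b) t)
    (hz : ∀ t ∈ Icc a b, HasDerivWithinAt z (v (z t)) (Icc a b) t) (ha : y a = z a) :
    EqOn y z (Icc a b) := by
  have hyc : ContinuousOn y (Icc a b) := fun t ht => (hy t ht).continuousWithinAt
  have hzc : ContinuousOn z (Icc a b) := fun t ht => (hz t ht).continuousWithinAt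
  set s : Set ℝ := {t | y t = z t} with hs_def
  have hcl : IsClosed (s ∩ Icc a b) := by
    have hset : s ∩ Icc a b = Icc a b ∩ (fun t => y t - z t) ⁻¹' {0} := by
      ext t
      simp only [hs_def, mem_inter_iff, mem_setOf_eq, mem_preimage, mem_singleton_iff, sub_eq_zero]
      exact and_comm
    rw [hset]
    exact (hyc.sub hzc).preimage_isClosed_of_isClosed isClosed_Icc isClosed_singleton
  have key : Icc a b ⊆ s := by
    refine hcl.Icc_subset_of_forall_mem_nhdsWithin ha ?_
    rintro x ⟨hx, hxab⟩
    have hxI : x ∈ Icc a b := Ico_subset_Icc_self hxab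
    obtain ⟨K, U, hU, hK⟩ := hv x hxI
    obtain ⟨ε, hε, hεU⟩ := Metric.mem_nhds_iff.1 hU
    have hyx : ∀ᶠ t in 𝓝[Icc a b] x, y t ∈ ball (y x) ε := hyc x hxI (ball_mem_nhds _ hε)
    have hzx : ∀ᶠ t in 𝓝[Icc a b] x, z t ∈ ball (y x) ε := by
      have h1 : ∀ᶠ t in 𝓝[Icc a b] x, z t ∈ ball (z x) ε := hzc x hxI (ball_mem_nhds _ hε)
      have h2 : z x = y x := (show y x = z x from hx).symm
      simpa only [h2] using h1
    obtain ⟨δ, hδ, hδP⟩ := Metric.mem_nhdsWithin_iff.1 (hyx.and hzx)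
    set b' : ℝ := min b (x + δ / 2) with hb'
    have hxb' : x < b' := lt_min hxab.2 (by linarith)
    have hb'b : b' ≤ b := min_le_left _ _
    have hsub : Icc x b' ⊆ Icc a b := fun t ht => ⟨hxI.1.trans ht.1, ht.2.trans hb'b⟩
    have hnear : ∀ t ∈ Icc x b', y t ∈ U ∧ z t ∈ U := by
      intro t ht
      have hdist : dist t x < δ := by
        rw [Real.dist_eq, abs_of_nonneg (sub_nonneg.2 ht.1)]
        have : t ≤ x + δ / 2 := ht.2.trans (min_le_right _ _)
        linarith
      have hmem : t ∈ {t | y t ∈ ball (y x) ε ∧ z t ∈ ball (y x) ε} :=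
        hδP ⟨mem_ball.2 hdist, hsub ht⟩
      exact ⟨hεU hmem.1, hεU hmem.2⟩
    have hnhds : ∀ t ∈ Ico x b', Icc a b ∈ 𝓝[≥] t := fun t ht =>
      mem_of_superset (Icc_mem_nhdsGE (ht.2.trans_le hb'b))
        (Icc_subset_Icc_left (hxI.1.trans ht.1))
    have hEq : EqOn y z (Icc x b') :=
      ODE_solution_unique_of_mem_Icc_right (v := fun _ => v) (s := fun _ => U) (K := K)
        (fun _ _ => hK) (hyc.mono hsub)
        (fun t ht => (hy t (hsub (Ico_subset_Icc_self ht))).mono_of_mem_nhdsWithin (hnhds t ht))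
        (fun t ht => (hnear t (Ico_subset_Icc_self ht)).1) (hzc.mono hsub)
        (fun t ht => (hz t (hsub (Ico_subset_Icc_self ht))).mono_of_mem_nhdsWithin (hnhds t ht))
        (fun t ht => (hnear t (Ico_subset_Icc_self ht)).2) hx
    exact mem_of_superset (Icc_mem_nhdsGT hxb') fun t ht => hEq ht
  exact fun t ht => key ht

/-- A field that is `C^∞` on an open set `Ω` is Lipschitz on a neighbourhood of every point of
`Ω` (Teschl 2012 §2.2 Problem 2.5: `C¹` implies locally Lipschitz, via the mean value
inequality). [cite: Teschl2012, §2.2 Problem 2.5] -/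
theorem exists_lipschitzOnWith_nhds_of_contDiffOn {F : Type*} [NormedAddCommGroup F]
    [NormedSpace ℝ F] {f : E → F} {Ω : Set E} (hΩ : IsOpen Ω) (hf : ContDiffOn ℝ ∞ f Ω)
    {x : E} (hx : x ∈ Ω) : ∃ K : ℝ≥0, ∃ U ∈ 𝓝 x, LipschitzOnWith K f U :=
  ((hf.contDiffAt (hΩ.mem_nhds hx)).of_le (by exact_mod_cast le_top)).exists_lipschitzOnWith

end Uniqueness

/-! ### The HOE step with a local Lipschitz hypothesis on the a-priori box only -/

section HOE

variable {ι : Type*} [Fintype ι]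

/-- **High-order a priori enclosure test: every solution is enclosed — local form.**  Under the
test of `exists_solution_of_highOrderEnclosure` (Nedialkov–Jackson–Pryce 2001 §3), if `f` is
Lipschitz on some neighbourhood of every point of the a-priori box `S` (for instance `f ∈ C¹(Ω)`
on an open `Ω ⊇ S`), then EVERY solution `z` of `z' = f(z)` on `[0, h]` with `z 0 = y₀`
satisfies `z t = ∑_{j<K} t^j • Φ j y₀ + t^K • v_t`, `v_t ∈ [c, d]`, in particular `z t ∈ S`, for
all `t ∈ [0, h]`: the solution produced by the test stays in `S`, and uniqueness along it needs
the Lipschitz condition only there (Teschl 2012 §2.6).  This replaces the growth hypothesis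
`hloc` (Lipschitz on all bounded sets) of `solution_mem_of_highOrderEnclosure`.
[cite: NedialkovJacksonPryce2001, §3 (HOE existence test)]
[cite: Teschl2012, §2.6 (uniqueness on the common interval, before Theorem 2.13)] -/
theorem solution_mem_of_highOrderEnclosure_local {f : (ι → ℝ) → ι → ℝ}
    {Φ : ℕ → (ι → ℝ) → ι → ℝ} {Φ' : ℕ → (ι → ℝ) → ((ι → ℝ) →L[ℝ] (ι → ℝ))} {Ω S : Set (ι → ℝ)}
    {K : ℕ} (hK : 0 < K) {L : ℝ≥0} {B : ℝ} {c d y₀ : ι → ℝ} {h : ℝ} (hSΩ : S ⊆ Ω)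
    (hΦ0 : ∀ x, Φ 0 x = x) (hder : ∀ j < K, ∀ x ∈ Ω, HasFDerivAt (Φ j) (Φ' j x) x)
    (hrec : ∀ j < K, ∀ x ∈ Ω, Φ' j x (f x) = ((j : ℝ) + 1) • Φ (j + 1) x)
    (hbd : ∀ j < K, ∀ x ∈ S, ‖Φ' j x‖ ≤ B) (hlipK : LipschitzOnWith L (Φ K) S) (hcd : c ≤ d)
    (hKS : MapsTo (Φ K) S (Icc c d)) (hh : 0 ≤ h)
    (hincl : ∀ t ∈ Icc 0 h, ∀ v ∈ Icc c d,
      (∑ j ∈ Finset.range K, t ^ j • Φ j y₀) + t ^ K • v ∈ S)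
    (hfl : ∀ x ∈ S, ∃ K' : ℝ≥0, ∃ U ∈ 𝓝 x, LipschitzOnWith K' f U) {z : ℝ → ι → ℝ}
    (hz0 : z 0 = y₀) (hz : ∀ t ∈ Icc 0 h, HasDerivWithinAt z (f (z t)) (Icc 0 h) t) {t : ℝ}
    (ht : t ∈ Icc 0 h) :
    z t ∈ S ∧ ∃ v ∈ Icc c d, z t = (∑ j ∈ Finset.range K, t ^ j • Φ j y₀) + t ^ K • v := by
  obtain ⟨y, hy0, hy, hyS⟩ :=
    exists_solution_of_highOrderEnclosure hK hSΩ hΦ0 hder hrec hbd hlipK hcd hKS hh hincl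
  have hEq : EqOn y z (Icc 0 h) :=
    ODE_solution_unique_of_lipschitzOnWith_nhds (fun s hs => hfl (y s) (hyS s hs).1) hy hz
      (hy0.trans hz0.symm)
  rw [← hEq ht]
  exact hyS t ht

/-- **The step form of the high-order enclosure test — local form.**  As
`highOrderEnclosure_step` (Nedialkov–Jackson–Pryce 2001 §3: for every `y₀ ∈ W` a solution of
`y' = f(y)`, `y(0) = y₀` exists on `[0, h]`, and every such solution satisfies
`y t ∈ ∑_{j<K} t^j • Φ j y₀ + t^K • [c, d] ⊆ S`), with the growth hypothesis `hloc` replaced by: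
`f` is Lipschitz on a neighbourhood of each point of `S`.
[cite: NedialkovJacksonPryce2001, §3 (HOE existence test)]
[cite: Teschl2012, §2.6 (uniqueness on the common interval, before Theorem 2.13)] -/
theorem highOrderEnclosure_step_local {f : (ι → ℝ) → ι → ℝ}
    {Φ : ℕ → (ι → ℝ) → ι → ℝ} {Φ' : ℕ → (ι → ℝ) → ((ι → ℝ) →L[ℝ] (ι → ℝ))} {Ω S W : Set (ι → ℝ)}
    {K : ℕ} (hK : 0 < K) {L : ℝ≥0} {B : ℝ} {c d : ι → ℝ} {h : ℝ} (hSΩ : S ⊆ Ω)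
    (hΦ0 : ∀ x, Φ 0 x = x) (hder : ∀ j < K, ∀ x ∈ Ω, HasFDerivAt (Φ j) (Φ' j x) x)
    (hrec : ∀ j < K, ∀ x ∈ Ω, Φ' j x (f x) = ((j : ℝ) + 1) • Φ (j + 1) x)
    (hbd : ∀ j < K, ∀ x ∈ S, ‖Φ' j x‖ ≤ B) (hlipK : LipschitzOnWith L (Φ K) S) (hcd : c ≤ d)
    (hKS : MapsTo (Φ K) S (Icc c d)) (hh : 0 ≤ h)
    (hfl : ∀ x ∈ S, ∃ K' : ℝ≥0, ∃ U ∈ 𝓝 x, LipschitzOnWith K' f U)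
    (hincl : ∀ y₀ ∈ W, ∀ t ∈ Icc 0 h, ∀ v ∈ Icc c d,
      (∑ j ∈ Finset.range K, t ^ j • Φ j y₀) + t ^ K • v ∈ S)
    {y₀ : ι → ℝ} (hy₀ : y₀ ∈ W) :
    (∃ y : ℝ → ι → ℝ, y 0 = y₀ ∧ ∀ t ∈ Icc 0 h, HasDerivWithinAt y (f (y t)) (Icc 0 h) t) ∧
      ∀ z : ℝ → ι → ℝ, z 0 = y₀ → (∀ t ∈ Icc 0 h, HasDerivWithinAt z (f (z t)) (Icc 0 h) t) →
        ∀ t ∈ Icc 0 h, z t ∈ S ∧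
          ∃ v ∈ Icc c d, z t = (∑ j ∈ Finset.range K, t ^ j • Φ j y₀) + t ^ K • v := by
  refine ⟨?_, fun z hz0 hz t ht => solution_mem_of_highOrderEnclosure_local hK hSΩ hΦ0 hder hrec
    hbd hlipK hcd hKS hh (hincl y₀ hy₀) hfl hz0 hz ht⟩
  obtain ⟨y, hy0, hy, -⟩ :=
    exists_solution_of_highOrderEnclosure hK hSΩ hΦ0 hder hrec hbd hlipK hcd hKS hh (hincl y₀ hy₀)
  exact ⟨y, hy0, hy⟩

end HOE

/-! ### Smooth fields on an open domain: no growth hypothesis -/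

section Smooth

variable {ι : Type*} [Fintype ι] {Ω : Opens (ι → ℝ)} {f : (ι → ℝ) → ι → ℝ}

/-- **High-order enclosure step for a field smooth on an open set — no growth hypothesis.**
Let `f ∈ C^∞(Ω; ℝ^ι)` on an open `Ω`, `K ≥ 1`, `S ⊆ Ω` compact and convex with `Φ_K(S) ⊆ [c, d]`
(`Φ_j = smoothTaylorMap hf j = (1/j!) L_f^j Id`), `h ≥ 0`, and suppose the inclusion test
`∑_{j<K} t^j Φ_j(y₀) + t^K [c, d] ⊆ S` for all `t ∈ [0, h]`, `y₀ ∈ W`.  Then for every `y₀ ∈ W`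
a solution of `y' = f(y)`, `y(0) = y₀` exists on `[0, h]`, and every solution `z` from `y₀`
satisfies `z(t) = ∑_{j<K} t^j Φ_j(y₀) + t^K v_t`, `v_t ∈ [c, d]`, in particular `z(t) ∈ S` —
`highOrderEnclosure_step_smoothOn` without its hypothesis `hloc`, so that fields with
singularities off `Ω` (quotients, logarithms, roots, real powers: Moore 1979 §3.4 (3.19)) are
covered.  [cite: NedialkovJacksonPryce2001, §3 (HOE existence test)]
[cite: Moore1979, §3.4 eqs. (3.13)–(3.19)]
[cite: Teschl2012, §2.6 (uniqueness on the common interval, before Theorem 2.13)] -/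
theorem highOrderEnclosure_step_smoothOn_local (hf : ContDiffOn ℝ ∞ f (Ω : Set (ι → ℝ)))
    {K : ℕ} (hK : 0 < K) {S W : Set (ι → ℝ)} {c d : ι → ℝ} {h : ℝ} (hSΩ : S ⊆ Ω)
    (hS : IsCompact S) (hSc : Convex ℝ S) (hcd : c ≤ d)
    (hKS : MapsTo (smoothTaylorMap hf K) S (Icc c d)) (hh : 0 ≤ h)
    (hincl : ∀ y₀ ∈ W, ∀ t ∈ Icc 0 h, ∀ v ∈ Icc c d,
      (∑ j ∈ Finset.range K, t ^ j • smoothTaylorMap hf j y₀) + t ^ K • v ∈ S)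
    {y₀ : ι → ℝ} (hy₀ : y₀ ∈ W) :
    (∃ y : ℝ → ι → ℝ, y 0 = y₀ ∧ ∀ t ∈ Icc 0 h, HasDerivWithinAt y (f (y t)) (Icc 0 h) t) ∧
      ∀ z : ℝ → ι → ℝ, z 0 = y₀ → (∀ t ∈ Icc 0 h, HasDerivWithinAt z (f (z t)) (Icc 0 h) t) →
        ∀ t ∈ Icc 0 h, z t ∈ S ∧ ∃ v ∈ Icc c d,
          z t = (∑ j ∈ Finset.range K, t ^ j • smoothTaylorMap hf j y₀) + t ^ K • v := by
  obtain ⟨B, hB⟩ := exists_bound_smoothTaylorFDeriv hf K hS hSΩ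
  obtain ⟨L, hL⟩ := exists_lipschitzOnWith_smoothTaylorMap hf K hS hSc hSΩ
  exact highOrderEnclosure_step_local hK hSΩ (smoothTaylorMap_zero hf)
    (fun j _ x hx => hasFDerivAt_smoothTaylorMap hf j hx)
    (fun j _ x hx => smoothTaylorFDeriv_apply_field hf j hx) hB hL hcd hKS hh
    (fun x hx => exists_lipschitzOnWith_nhds_of_contDiffOn Ω.isOpen hf (hSΩ hx)) hincl hy₀

/-- **The box-data HOE test for a field smooth on an open set — no growth hypothesis.**  For
`f ∈ C^∞(Ω; ℝ^ι)`, `K ≥ 1`, `h ≥ 0`, `T ⊇ [0, h]`, boxes `W`, `S` with `boxSet S ⊆ Ω`, sound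
enclosures `E_j ⊇ Φ_j(W)` (`j < K`) and `V ⊇ Φ_K(S)`, the single containment
`∑_{j<K} T^j · E_j + T^K · V ⊆ S` yields existence on `[0, h]` and the enclosure of every
solution from `W` in `S` and in `∑_{j<K} t^j Φ_j(y₀) + t^K · V` (Moore 1979 §8.1 (8.10), (8.13);
Nedialkov–Jackson–Pryce 2001 §3) — `highOrderEnclosure_step_intervalTest_smoothOn` without
`hloc`. [cite: NedialkovJacksonPryce2001, §3 (HOE existence test)]
[cite: Moore1979, §8.1 eqs. (8.10), (8.13)] [cite: NedialkovJacksonCorliss1999, §5 Algorithm I] -/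
theorem highOrderEnclosure_step_intervalTest_smoothOn_local
    (hf : ContDiffOn ℝ ∞ f (Ω : Set (ι → ℝ))) {K : ℕ} (hK : 0 < K) {h : ℝ} (hh : 0 ≤ h)
    {T : NonemptyInterval ℝ} (hT : ∀ t ∈ Icc 0 h, t ∈ T) (W S V : ι → NonemptyInterval ℝ)
    (E : ℕ → ι → NonemptyInterval ℝ) (hSΩ : boxSet S ⊆ Ω)
    (hE : ∀ j < K, MapsTo (smoothTaylorMap hf j) (boxSet W) (boxSet (E j)))
    (hV : MapsTo (smoothTaylorMap hf K) (boxSet S) (boxSet V)) (htest : hoeBox T E V K ≤ S)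
    {y₀ : ι → ℝ} (hy₀ : y₀ ∈ boxSet W) :
    (∃ y : ℝ → ι → ℝ, y 0 = y₀ ∧
        ∀ t ∈ Icc 0 h, HasDerivWithinAt y (f (y t)) (Icc 0 h) t) ∧
      ∀ z : ℝ → ι → ℝ, z 0 = y₀ →
        (∀ t ∈ Icc 0 h, HasDerivWithinAt z (f (z t)) (Icc 0 h) t) →
          ∀ t ∈ Icc 0 h, z t ∈ boxSet S ∧ ∃ v ∈ boxSet V,
            z t = (∑ j ∈ Finset.range K, t ^ j • smoothTaylorMap hf j y₀) + t ^ K • v :=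
  highOrderEnclosure_step_smoothOn_local hf hK hSΩ (isCompact_boxSet S) (convex_boxSet S)
    (boxLo_le_boxHi V) hV hh (hincl_of_hoeBox hT hE htest) hy₀

/-- **The Taylor tube over the step, open-domain field** (Moore 1979 (8.10)): under the
hypotheses of `highOrderEnclosure_step_intervalTest_smoothOn_local`, every solution from
`y₀ ∈ W` satisfies `z(t) ∈ ∑_{j<K} T^j · E_j + T^K · V` for all `t ∈ [0, h]`.
[cite: Moore1979, §8.1 eq. (8.10)] [cite: NedialkovJacksonPryce2001, §3 (HOE existence test)] -/
theorem highOrderEnclosure_tube_smoothOn_local (hf : ContDiffOn ℝ ∞ f (Ω : Set (ι → ℝ)))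
    {K : ℕ} (hK : 0 < K) {h : ℝ} (hh : 0 ≤ h) {T : NonemptyInterval ℝ}
    (hT : ∀ t ∈ Icc 0 h, t ∈ T) (W S V : ι → NonemptyInterval ℝ)
    (E : ℕ → ι → NonemptyInterval ℝ) (hSΩ : boxSet S ⊆ Ω)
    (hE : ∀ j < K, MapsTo (smoothTaylorMap hf j) (boxSet W) (boxSet (E j)))
    (hV : MapsTo (smoothTaylorMap hf K) (boxSet S) (boxSet V)) (htest : hoeBox T E V K ≤ S)
    {y₀ : ι → ℝ} (hy₀ : y₀ ∈ boxSet W) {z : ℝ → ι → ℝ} (hz0 : z 0 = y₀)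
    (hz : ∀ t ∈ Icc 0 h, HasDerivWithinAt z (f (z t)) (Icc 0 h) t) {t : ℝ} (ht : t ∈ Icc 0 h) :
    z t ∈ boxSet (hoeBox T E V K) := by
  obtain ⟨-, huniq⟩ :=
    highOrderEnclosure_step_intervalTest_smoothOn_local hf hK hh hT W S V E hSΩ hE hV htest hy₀
  obtain ⟨-, v, hv, hzv⟩ := huniq z hz0 hz t ht
  rw [hzv]
  exact taylorSum_mem_hoeBox (hT t ht) (fun j hj => hE j hj hy₀) hv

/-- **The tight enclosure at the end of the step, open-domain field** (Moore 1979 (8.10) at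
`t = t₁`; the input of Lohner's / NJC's Algorithm II): under the hypotheses of
`highOrderEnclosure_step_intervalTest_smoothOn_local`, every solution `z` from `y₀ ∈ W`
satisfies `z(h) ∈ ∑_{j<K} [h, h]^j · E_j + [h, h]^K · V`. [cite: Moore1979, §8.1 eq. (8.10)]
[cite: NedialkovJacksonCorliss1999, §5 Algorithm I] -/
theorem highOrderEnclosure_endpoint_smoothOn_local (hf : ContDiffOn ℝ ∞ f (Ω : Set (ι → ℝ)))
    {K : ℕ} (hK : 0 < K) {h : ℝ} (hh : 0 ≤ h) {T : NonemptyInterval ℝ}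
    (hT : ∀ t ∈ Icc 0 h, t ∈ T) (W S V : ι → NonemptyInterval ℝ)
    (E : ℕ → ι → NonemptyInterval ℝ) (hSΩ : boxSet S ⊆ Ω)
    (hE : ∀ j < K, MapsTo (smoothTaylorMap hf j) (boxSet W) (boxSet (E j)))
    (hV : MapsTo (smoothTaylorMap hf K) (boxSet S) (boxSet V)) (htest : hoeBox T E V K ≤ S)
    {y₀ : ι → ℝ} (hy₀ : y₀ ∈ boxSet W) {z : ℝ → ι → ℝ} (hz0 : z 0 = y₀)
    (hz : ∀ t ∈ Icc 0 h, HasDerivWithinAt z (f (z t)) (Icc 0 h) t) :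
    z h ∈ boxSet (hoeBox (NonemptyInterval.pure h) E V K) := by
  obtain ⟨-, huniq⟩ :=
    highOrderEnclosure_step_intervalTest_smoothOn_local hf hK hh hT W S V E hSΩ hE hV htest hy₀
  obtain ⟨-, v, hv, hzv⟩ := huniq z hz0 hz h ⟨hh, le_rfl⟩
  rw [hzv]
  exact taylorSum_mem_hoeBox (mem_pure_self h) (fun j hj => hE j hj hy₀) hv

end Smooth

end Literature.Analysis.ODE
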